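import Mathlib.Tactic.NormNum.Prime
import Mathlib.Tactic.IntervalCases
import Literature.NumberTheory.EllipticCurves.RationalIsogenyDegreesProofs
import HarnessLib

/-!
# The middle curve of a cyclic rational `49`-isogeny (Kenku's level `49 = 7·7`, first step)

Topic `NumberTheory/EllipticCurves`; a PROOFS file (theorems only, no `def`, no named fact; net
debt `0`). File 2 of 4 of the `Literature/` PORT of the tree's proved level-`49` theorem of Kenku
(no elliptic curve over `ℚ` has a rational cyclic `49`-isogeny — the `n = 49` leaf of Mazur's
"First reduction", named fact
`Literature.NumberTheory.EllipticCurves.Mazur1977_reduction_to_primes`).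

PORT. Source (PROVED, Summits-side, read-only here):
`Summits/ABC/ABC/Theorems/IsogenyGlueCongruenceMazurKenkuBoundStubMiddleSeven.lean` (proposal
p172906, route `IsogenyGlueCongruence`, crux `MazurKenkuBound`; sha256 in the `-- PORT:` line 1).
Ported declaration, 1 : 1, statement and tactic script VERBATIM, namespace
`Summit.ABC.ABC.Theorems` ↦ `Literature.NumberTheory.EllipticCurves`, name unchanged except that
the crux prefix `stub_` is dropped: `stub_middleSeven` ↦ `middleSeven`. Nothing is re-stated
beyond this renaming (a `Literature/` file may not import `Summits.*`, CONVENTIONS §2, so the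
Summits twin cannot be re-used by `import`); the Summits file is untouched. Ported by
bsd-cited-r19 (ARM P lead ruling (452)(a), OPS 2026-08-27T09:49Z).

WHAT. Kenku's level `49 = 7·7` of the rational-isogeny tables, first step (`X₀(49) ≅ X_sp(7)` on the
abstract middle curve): a cyclic `ℚ`-isogeny `ψ : V → V'` of degree `49` has kernel `ℤP` with
`P ∈ V(ℚ̄)` of order `49` and `Γ_ℚ`-stable `ℤP`; `Q = 7P` has order `7` and `S = ℤQ ⊆ V[7]` is a
finite `Γ_ℚ`-stable subgroup of order `7`. The tree's PROVED quotient theorem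
`WeierstrassCurve.exists_isogeny_ker_eq_and_comp_eq_nsmul_holds` (Silverman, *AEC*, Prop. III.4.12
with Rem. III.4.13.2) gives an elliptic curve `V₁ = V/S` over `ℚ` and an isogeny `g : V → V₁`
over `ℚ` with `ker g = S`. On `V₁`:

* `P₁ = g P` has order `7` (`7 • g P = g Q = 0`, and `g P ≠ 0` because `P ∉ S ⊆ V[7]`), and
  `ℤP₁` is `Γ_ℚ`-stable because `ℤP` is and `g` commutes with `Γ_ℚ`;
* `P₂ = g T` for any `T ∈ V[7] ∖ S` (which exists as `#V[7] = 49 > 7 = #S`, the tree's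
  `natCard_geomTorsion_eq_sq`, *AEC* Cor. III.6.4(b)) has order `7`, and `ℤP₂` is `Γ_ℚ`-stable
  because `V[7] = ℤT ⊔ S` (a subgroup of `V[7]` strictly containing `S` has order `49`), so
  `σ • T = kT + s` with `s ∈ S = ker g`;
* `P₂ ∉ ℤP₁`: `g T = n • g P` gives `T - nP ∈ S ⊆ V[7]`, so `nP ∈ V[7]`, `49 ∣ 7n`, `7 ∣ n`,
  `nP ∈ ℤQ = S` and `T ∈ S`, a contradiction.

* `middleSeven`: the statement above (input A of the level-`49` glue `levelFortyNineGlue`, file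
  `KenkuLevelFortyNineProofs`).

## References

* [SilvermanAEC2009] J. H. Silverman, *The Arithmetic of Elliptic Curves*, 2nd ed., GTM 106:
  Prop. III.4.12, Rem. III.4.13.2 (quotient by a finite `Γ_K`-stable subgroup), Cor. III.6.4(b)
  (`#E[m] = m²`).
* [Kenku1982] M. A. Kenku, J. Number Theory 15 (1982) 199–202, proof of Thm. 1 (level `49`).

## Design

Theorems only (no definitions, no new facts); everything used is proved in the tree
(`exists_isogeny_ker_eq_and_comp_eq_nsmul_holds`, `natCard_geomTorsion_eq_sq`,
`finite_geomTorsion_natCast`, the `Isogeny` prelude) or in Mathlib (cyclic groups, `zmultiples`,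
`torsionBy`, Lagrange).
-/

noncomputable section

open scoped Classical

open WeierstrassCurve

namespace Literature.NumberTheory.EllipticCurves

/-- **The middle curve of a cyclic rational `49`-isogeny.** A cyclic `ℚ`-isogeny `ψ : V → V'` of
degree `49` out of an elliptic curve `V/ℚ` yields an elliptic curve `V₁/ℚ` (the quotient of `V` by
the order-`7` subgroup `ℤ(7P)` of `ker ψ = ℤP`, Silverman, *AEC*, Prop. III.4.12 with
Rem. III.4.13.2, the tree's `exists_isogeny_ker_eq_and_comp_eq_nsmul_holds`) carrying two points
`P₁, P₂ ∈ V₁(ℚ̄)` of order `7` whose cyclic subgroups are `Γ_ℚ`-stable and distinct (the image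
`g P` of the generator of the kernel and the image `g T` of a point `T ∈ V[7]` off `ℤ(7P)`,
`#V[7] = 49` by *AEC* Cor. III.6.4(b)). PORT of the Summits-side
`Summit.ABC.ABC.Theorems.stub_middleSeven` (p172906), statement verbatim.
[cite: SilvermanAEC2009, Prop. III.4.12 and Rem. III.4.13.2]
[cite: Kenku1982, proof of Thm. 1, p. 200] -/
theorem middleSeven :
    ∀ (V V' : WeierstrassCurve ℚ) [V.IsElliptic] [V'.IsElliptic] (ψ : Isogeny V V'),
      ψ.IsCyclic → ψ.degree = 49 →
      ∃ (V₁ : WeierstrassCurve ℚ) (_ : V₁.IsElliptic) (P₁ P₂ : V₁.geomPoints),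
        addOrderOf P₁ = 7 ∧ addOrderOf P₂ = 7 ∧
        (∀ σ : Field.absoluteGaloisGroup ℚ, σ • P₁ ∈ AddSubgroup.zmultiples P₁) ∧
        (∀ σ : Field.absoluteGaloisGroup ℚ, σ • P₂ ∈ AddSubgroup.zmultiples P₂) ∧
        P₂ ∉ AddSubgroup.zmultiples P₁ := by
  intro V V' _ _ ψ hψ hdeg
  haveI : Fact (Nat.Prime 7) := ⟨by norm_num⟩
  -- Step 1: a generator `P` of `ker ψ`, of order `49`, with `Γ_ℚ`-stable `ℤP = ker ψ`.
  haveI : IsAddCyclic ψ.toAddMonoidHom.ker := hψ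
  obtain ⟨g₀, hg₀⟩ := IsAddCyclic.exists_ofOrder_eq_natCard (α := ψ.toAddMonoidHom.ker)
  set P : V.geomPoints := (g₀ : V.geomPoints) with hPdef
  have hordP : addOrderOf P = 49 := by
    rw [hPdef, AddSubgroup.addOrderOf_coe, hg₀]
    exact hdeg
  have hgen : AddSubgroup.zmultiples P = ψ.toAddMonoidHom.ker := by
    apply AddSubgroup.eq_of_le_of_card_ge (AddSubgroup.zmultiples_le_of_mem g₀.2)
    rw [Nat.card_zmultiples, hordP]
    exact hdeg.le
  have hP0 : ψ P = 0 := (AddMonoidHom.mem_ker).mp g₀.2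
  have hstP : ∀ σ : Field.absoluteGaloisGroup ℚ, σ • P ∈ AddSubgroup.zmultiples P := fun σ ↦ by
    rw [hgen, AddMonoidHom.mem_ker, Isogeny.coe_toAddMonoidHom, ψ.map_smul, hP0, smul_zero]
  -- Step 2: `Q = 7P` has order `7`; `S = ℤQ ⊆ V[7]` is finite, of order `7`, `Γ_ℚ`-stable.
  set Q : V.geomPoints := (7 : ℕ) • P with hQdef
  have hordQ : addOrderOf Q = 7 := by
    rw [hQdef, addOrderOf_nsmul_of_dvd (by norm_num) (by rw [hordP]; norm_num), hordP]
  have hQ7 : (7 : ℕ) • Q = 0 := by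
    rw [← hordQ]
    exact addOrderOf_nsmul_eq_zero Q
  set S : AddSubgroup V.geomPoints := AddSubgroup.zmultiples Q with hSdef
  have hScard : Nat.card S = 7 := by
    rw [hSdef, Nat.card_zmultiples, hordQ]
  haveI : Finite S := Nat.finite_of_card_ne_zero (by rw [hScard]; norm_num)
  have hSfin : (S : Set V.geomPoints).Finite := Set.toFinite _
  have hS7 : S ≤ geomTorsion V ((7 : ℕ) : ℤ) :=
    AddSubgroup.zmultiples_le_of_mem (AddSubgroup.torsionBy.nsmul_iff.mpr hQ7)
  have hSstab : ∀ (σ : Field.absoluteGaloisGroup ℚ) (R : V.geomPoints), R ∈ S → σ • R ∈ S := by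
    intro σ R hR
    obtain ⟨k, rfl⟩ := AddSubgroup.mem_zmultiples_iff.mp hR
    obtain ⟨m, hm⟩ := AddSubgroup.mem_zmultiples_iff.mp (hstP σ)
    have hσQ : σ • Q = m • Q := by
      rw [hQdef, smul_comm σ (7 : ℕ) P, ← hm, smul_comm (7 : ℕ) m P]
    rw [smul_comm σ k Q, hσQ]
    exact S.zsmul_mem (S.zsmul_mem (AddSubgroup.mem_zmultiples Q) m) k
  -- Step 3: the quotient `V₁ = V/S` and `g : V → V₁` with `ker g = S` (AEC III.4.12, 4.13.2).
  obtain ⟨V₁, hV₁, g, -, hker, -, -⟩ :=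
    V.exists_isogeny_ker_eq_and_comp_eq_nsmul_holds S hSfin hSstab
  have hker' : ∀ R : V.geomPoints, g R = 0 ↔ R ∈ S := fun R ↦ by
    rw [← hker, AddMonoidHom.mem_ker, Isogeny.coe_toAddMonoidHom]
  -- Step 4: a point `T ∈ V[7]` off `S` (`#V[7] = 49 > 7`).
  haveI : Finite (geomTorsion V ((7 : ℕ) : ℤ)) := finite_geomTorsion_natCast V (by norm_num)
  have hcard7 : Nat.card (geomTorsion V ((7 : ℕ) : ℤ)) = 49 := by
    rw [natCard_geomTorsion_eq_sq V (by norm_num)]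
    norm_num
  obtain ⟨T, hT7, hTS⟩ : ∃ T ∈ geomTorsion V ((7 : ℕ) : ℤ), T ∉ S := by
    by_contra h
    push Not at h
    have hdvd := AddSubgroup.card_dvd_of_le (show geomTorsion V ((7 : ℕ) : ℤ) ≤ S from h)
    rw [hcard7, hScard] at hdvd
    omega
  have hT7' : (7 : ℕ) • T = 0 := AddSubgroup.torsionBy.nsmul_iff.mp hT7
  have hPS : P ∉ S := fun h ↦ by
    have h7P : (7 : ℕ) • P = 0 := AddSubgroup.torsionBy.nsmul_iff.mp (hS7 h)
    have hdvd := addOrderOf_dvd_of_nsmul_eq_zero h7P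
    rw [hordP] at hdvd
    omega
  refine ⟨V₁, hV₁, g P, g T, ?_, ?_, ?_, ?_, ?_⟩
  · -- `g P` has order `7`
    refine addOrderOf_eq_prime ?_ fun h0 ↦ hPS ((hker' P).mp h0)
    rw [← map_nsmul]
    exact (hker' Q).mpr (AddSubgroup.mem_zmultiples Q)
  · -- `g T` has order `7`
    refine addOrderOf_eq_prime ?_ fun h0 ↦ hTS ((hker' T).mp h0)
    rw [← map_nsmul, hT7', map_zero]
  · -- `ℤ(g P)` is `Γ_ℚ`-stable
    intro σ
    obtain ⟨m, hm⟩ := AddSubgroup.mem_zmultiples_iff.mp (hstP σ)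
    rw [← g.map_smul, ← hm, map_zsmul]
    exact AddSubgroup.zsmul_mem _ (AddSubgroup.mem_zmultiples _) m
  · -- `ℤ(g T)` is `Γ_ℚ`-stable: `V[7] = ℤT ⊔ S`
    intro σ
    set H : AddSubgroup V.geomPoints := AddSubgroup.zmultiples T ⊔ S with hHdef
    have hHle : H ≤ geomTorsion V ((7 : ℕ) : ℤ) :=
      sup_le (AddSubgroup.zmultiples_le_of_mem hT7) hS7
    haveI : Finite H := Finite.of_injective _ (AddSubgroup.inclusion_injective hHle)
    have hHeq : H = geomTorsion V ((7 : ℕ) : ℤ) := by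
      apply AddSubgroup.eq_of_le_of_card_ge hHle
      have h1 : Nat.card H ∣ 7 ^ 2 := by
        have := AddSubgroup.card_dvd_of_le hHle
        rwa [hcard7] at this
      have h2 : 7 ∣ Nat.card H := by
        have := AddSubgroup.card_dvd_of_le (le_sup_right : S ≤ H)
        rwa [hScard] at this
      have h3 : Nat.card H ≠ 7 := fun h ↦ hTS <| by
        have hSH : S = H :=
          AddSubgroup.eq_of_le_of_card_ge (le_sup_right : S ≤ H) (by rw [h, hScard])
        rw [hSH]
        exact (le_sup_left : AddSubgroup.zmultiples T ≤ H) (AddSubgroup.mem_zmultiples T)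
      obtain ⟨i, hi, hHi⟩ := (Nat.dvd_prime_pow (by norm_num : Nat.Prime 7)).mp h1
      interval_cases i
      · rw [hHi] at h2
        norm_num at h2
      · exact absurd (hHi.trans (pow_one 7)) h3
      · rw [hcard7, hHi]
        norm_num
    have hσT : σ • T ∈ H := by
      rw [hHeq]
      exact smul_mem_torsionBy σ hT7
    obtain ⟨y, hy, z, hz, hyz⟩ := AddSubgroup.mem_sup.mp hσT
    obtain ⟨k, rfl⟩ := AddSubgroup.mem_zmultiples_iff.mp hy
    rw [← g.map_smul, ← hyz, map_add, (hker' z).mpr hz, add_zero, map_zsmul]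
    exact AddSubgroup.zsmul_mem _ (AddSubgroup.mem_zmultiples _) k
  · -- `g T ∉ ℤ(g P)`
    intro hmem
    obtain ⟨n, hn⟩ := AddSubgroup.mem_zmultiples_iff.mp hmem
    have hTS' : T - n • P ∈ S := by
      rw [← hker' (T - n • P), map_sub, map_zsmul, hn, sub_self]
    have h7n : (((7 : ℕ) : ℤ) * n) • P = 0 := by
      have h1 : (7 : ℕ) • (T - n • P) = 0 := AddSubgroup.torsionBy.nsmul_iff.mp (hS7 hTS')
      rwa [smul_sub, hT7', zero_sub, neg_eq_zero, ← natCast_zsmul, smul_smul] at h1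
    have hdvd : ((addOrderOf P : ℕ) : ℤ) ∣ ((7 : ℕ) : ℤ) * n :=
      addOrderOf_dvd_iff_zsmul_eq_zero.mpr h7n
    rw [hordP] at hdvd
    push_cast at hdvd
    obtain ⟨m, rfl⟩ : (7 : ℤ) ∣ n := by omega
    apply hTS
    have hnP : ((7 : ℤ) * m) • P ∈ S := by
      rw [mul_comm, mul_smul, show ((7 : ℤ)) • P = Q by
        rw [hQdef, ← natCast_zsmul]; rfl]
      exact S.zsmul_mem (AddSubgroup.mem_zmultiples Q) m
    have := S.add_mem hTS' hnP
    rwa [sub_add_cancel] at this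

end Literature.NumberTheory.EllipticCurves

end
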